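import Summits.HodgeConjecture.CorCM.Model.Universe
import Summits.HodgeConjecture.CorCM.Geometry.Facts
import Summits.HodgeConjecture.HodgeConjecture.Theorems.CorCMDominationCommonField
import Literature.AlgebraicGeometry.ComplexMultiplication.ShimuraIsogenousPowerOfRiemann
import HarnessLib

/-!
# COR-CM model row M20: `Fact_cmDominated` (stage-1 M14) for the model of record `Model.universeOf hHD hI hU h₃`

Cell `pub-hodgecm2` (COR-CM = Hodge ladder stage 2), BINDER-OWNERS.md row **M20** (seat b18; proof body
staged by seat model-2, `HOME/pub-hodgecm2-model-2/lean/tree/CorCM/Model/CMDominated.lean`).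

CONTENT. The tree-level assembly `Summit.HodgeConjecture.CorCM.Domination.coded_cmDominated`
(`Summits/HodgeConjecture/HodgeConjecture/Theorems/CorCMDomination{,CMProduct,CommonField}.lean`): every
CM-flagged code `v` of the Picard–CM index type is dominated, up to a nonzero integer, by the product
`∏_j A_{(F,Θ_j)}` of realised CM codes over the COMMON Galois CM field `F = commonField v` of its leaves —
the compositum inside `ℂ` of the Galois closures of the leaf CM fields and of `ℚ(ζ₇)`; hence `F` is Galois
and `6 ≤ [F:ℚ]` for EVERY CM-flagged `v` (`Domination.six_le_finrank_commonField`), in particular for the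
codes of CM elliptic curves and CM surfaces, whose own CM fields have degree `2` or `4`: their CM types are
INDUCED to `F` along the leaf embeddings (`Domination.avDominatedBy_inflate_code`, Shimura 1998 §6.2
Theorem 3) — this is the "degree bound by enlarging `F`" of rfwf v3 Lemma 8.2 / `Universe.Lemma81`
(chain/SECTION-3 D4, R16). Here it is read in the literal shape of the package fact `U.Fact_cmDominated` for
`U = universeOf` (`U.cmProd F Θ` interprets to `(cmProdAV F h₃ n Θ).X`, factor by factor:
`scheme_cmProd_universeOf`).

BINDERS. The domination toolkit is stated over the two Shimura records `Shimura1998_Thm3_isogenousPower`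
(`hd`) and `Shimura1998_Thm2_Cor` (`hcor`); both are THEOREMS of the tree on the binders DISPLAYED by the
top statement `HC_CM_of_PerLFace` — Riemann's theorem `hR : DeligneMilne1982_Thm_6_20_full` (row B02)
and the record `h₃ : PicardCM.CMAbelianVarietyRealised` — via
`ComplexMultiplication.thm3_isogenousPower_of_riemann hR h₃` and `ComplexMultiplication.thm2_cor_of_riemann hR`
(`Literature/AlgebraicGeometry/ComplexMultiplication/ShimuraIsogenousPowerOfRiemann.lean`,
`…/ShimuraIsogenyOfRiemann.lean`). So the row is KERNEL modulo B02: `universeOf_fact_cmDominated (hR)`;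
the Shimura-binder form is kept as `universeOf_fact_cmDominated_of_shimura (hd) (hcor)`.

References: G. Shimura, *Abelian Varieties with Complex Multiplication and Modular Functions* (1998),
§6.1 Corollary of Theorem 2 (p. 41), §6.2 Theorem 3 (pp. 41–43), §18.2 Lemma (ii)–(iii);
P. Deligne, J. S. Milne, *Tannakian Categories*, LNM 900 (1982), Thm. 6.20 (print p. 212).
-/

noncomputable section

open CategoryTheory MonoidalCategory
open Literature.AlgebraicGeometry.Motives (CMType)
open Literature.AlgebraicGeometry.Motives
open Literature.AlgebraicGeometry.ComplexMultiplication (Shimura1998_Thm3_isogenousPower Shimura1998_Thm2_Cor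
  thm3_isogenousPower_of_riemann thm2_cor_of_riemann)
open Literature.AlgebraicGeometry.HodgeTheory (DeligneMilne1982_Thm_6_20_full)

namespace Summit.HodgeConjecture.CorCM

namespace Model

open Literature.NumberTheory.Automorphic
open Literature.NumberTheory.Automorphic.PicardCM (BallQuotientUniformisedDatum CMAbelianVarietyRealised
  BallQuotientUniformised ballQuotientUniformisedDatum_of)
open Literature.AlgebraicGeometry.HodgeTheory
open Summit.HodgeConjecture.CorCM.Domination

/-- The interpretation of the package product `U.cmProd F Θ` in `universeOf` IS, factor by factor, the
underlying variety of the tree's `cmProdAV F h₃ n Θ` (both are the left-nested product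
`(⋯(A_{Θ₀} × A_{Θ₁}) × ⋯) × A_{Θ_n}` of the chosen realisations). [folklore] -/
theorem scheme_cmProd_universeOf (hHD : exists_isReal_hodgeModel) (hI : hodgePQ_independent_of_hodgeModel)
    (hU : BallQuotientUniformisedDatum) (h₃ : CMAbelianVarietyRealised) (F : CMField) :
    ∀ (n : ℕ) (Θ : Fin (n + 1) → CMType F),
      PicardCM.Var.scheme hU h₃ ((universeOf hHD hI hU h₃).cmProd F Θ) = (cmProdAV F h₃ n Θ).X
  | 0, _ => rfl
  | n + 1, Θ => by
      change PicardCM.Var.scheme hU h₃ ((universeOf hHD hI hU h₃).cmProd F (fun i => Θ i.castSucc)) ⊗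
          PicardCM.Var.scheme hU h₃ ((universeOf hHD hI hU h₃).cmAV F (Θ (Fin.last (n + 1)))) = _
      rw [scheme_cmProd_universeOf hHD hI hU h₃ F n]
      rfl

/-- **M20 `Fact_cmDominated` for `universeOf`, Shimura-binder form** (over `hd`, `hcor`;
`Domination.coded_cmDominated`): for every CM-flagged code `X`, the common field `F = commonField X` is a
Galois CM field with `6 ≤ [F:ℚ]` (it receives `ℚ(ζ₇)`), and `X` is dominated by `U.cmProd F Θ` for a finite
family `Θ` of CM types of `F` (the leaf types induced to `F`), with `(π ∘ s)^* = N^k` on `H^k(−, ℚ)`, `N ≠ 0`.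
[cite: Shimura1998, §6.1 Corollary of Theorem 2, §6.2 Theorem 3, §18.2 Lemma (ii)–(iii)] -/
theorem universeOf_fact_cmDominated_of_shimura (hHD : exists_isReal_hodgeModel)
    (hI : hodgePQ_independent_of_hodgeModel) (hU : BallQuotientUniformisedDatum) (h₃ : CMAbelianVarietyRealised)
    (hd : Shimura1998_Thm3_isogenousPower) (hcor : Shimura1998_Thm2_Cor) :
    (universeOf hHD hI hU h₃).Fact_cmDominated := by
  intro X hX
  obtain ⟨F, _, _, _, hGal, h6, n, Θ, hdom⟩ := coded_cmDominated hU h₃ hd hcor X hX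
  obtain ⟨s, π, N, hN, hsπ⟩ :=
    hdom.of_iso_right (eqToIso (scheme_cmProd_universeOf hHD hI hU h₃ ⟨F⟩ n Θ).symm)
  exact ⟨⟨F⟩, hGal, h6, n, Θ, s, π, N, hN, hsπ⟩

/-- **M20 `Fact_cmDominated` for `universeOf` on the DISPLAYED binders of the top statement**: Riemann's
theorem `hR` (row B02) and the realisation record `h₃` give both Shimura inputs
(`thm3_isogenousPower_of_riemann hR h₃`, `thm2_cor_of_riemann hR`). KERNEL modulo B02.
[cite: Shimura1998, §6.1 Corollary of Theorem 2 (p. 41), §6.2 Theorem 3 (pp. 41–43), §18.2 Lemma (ii)–(iii);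
DeligneMilne1982Tannakian, §6 Thm. 6.20 (Riemann), print p. 212] -/
theorem universeOf_fact_cmDominated (hHD : exists_isReal_hodgeModel) (hI : hodgePQ_independent_of_hodgeModel)
    (hU : BallQuotientUniformisedDatum) (h₃ : CMAbelianVarietyRealised) (hR : DeligneMilne1982_Thm_6_20_full) :
    (universeOf hHD hI hU h₃).Fact_cmDominated :=
  universeOf_fact_cmDominated_of_shimura hHD hI hU h₃ (thm3_isogenousPower_of_riemann hR h₃)
    (thm2_cor_of_riemann hR)

/-- **M20 for the model of record `picardCMUniverse hHD hI h₁ h₃`** (`= universeOf` at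
`ballQuotientUniformisedDatum_of h₁`), on the displayed binder `hR`.
[cite: Shimura1998, §6.1 Corollary of Theorem 2, §6.2 Theorem 3; DeligneMilne1982Tannakian, §6 Thm. 6.20] -/
theorem picardCMUniverse_fact_cmDominated (hHD : exists_isReal_hodgeModel)
    (hI : hodgePQ_independent_of_hodgeModel) (h₁ : BallQuotientUniformised) (h₃ : CMAbelianVarietyRealised)
    (hR : DeligneMilne1982_Thm_6_20_full) : (picardCMUniverse hHD hI h₁ h₃).Fact_cmDominated :=
  universeOf_fact_cmDominated hHD hI _ h₃ hR

end Model

end Summit.HodgeConjecture.CorCM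

end
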